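import Summits.Schanuel.Schanuel.Theorems.ZilberEacLogTranscendence
import Mathlib.Analysis.Analytic.IsolatedZeros
import Mathlib.Analysis.Calculus.ImplicitContDiff
import Mathlib.Analysis.Calculus.FDeriv.Analytic
import Mathlib.Analysis.Calculus.Deriv.Inv
import Mathlib.Analysis.Calculus.ContDiff.Polynomial
import HarnessLib

/-!
# The equimodular class, XLII: the residue obstruction — no quotient of analytic functions is a
# primitive of `c·η'/η` at a zero of `η` — and the analytic branch of a fibre curve through a
# simple point

HONEST FRAMING.  Cell `pub-schanuel` (Zilber's Exponential-Algebraic Closedness, case ladder;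
host summit Schanuel), seat 2, gen 25.  The local-analytic half of the transcendence of the logarithm
of an algebraic branch of arbitrary degree (file XLIII):

* **`no_quotient_primitive_of_logDeriv`**: if `f, g, η` are analytic at `a`, `g ≢ 0`, `η(a) = 0`,
  `η ≢ 0`, `c ≠ 0`, then `f/g` does NOT have derivative `c·η'/η` on a punctured neighbourhood of
  `a` (write `g = (z-a)^k g₂`, `η = (z-a)^m u`, `f = (z-a)^j f₂` or `f ≡ 0`; multiply the identity by
  a suitable power of `z - a` and compare the two continuous sides AT `a`: one vanishes, the other is
  `c·m·u(a) ≠ 0` or `∓d·u(a)·v(a) ≠ 0`).  This is the "residue `≠ 0`" step, with no integration.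
* **`exists_zeroBranch`**: for `Q ∈ ℂ[s][t]` and a point `a` with `q₀(a) = 0 ≠ q₁(a)` there is an
  analytic `η` near `a` with `η(a) = 0` and `Q(z, η z) = 0` (implicit function theorem).

[folklore]; nothing here is specific to Schanuel's conjecture (neither used nor implied).
-/

noncomputable section

open Filter Topology Polynomial
open scoped ContDiff

set_option linter.dupNamespace false

namespace Summit.Schanuel.Schanuel.Theorems

/-! ## Part A. The residue obstruction -/

/-- Two functions continuous at `a` that agree on a punctured neighbourhood agree at `a`.
[folklore] -/
theorem eq_at_of_eventuallyEq_punctured {a : ℂ} {F G : ℂ → ℂ} (hF : ContinuousAt F a)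
    (hG : ContinuousAt G a) (h : ∀ᶠ z in 𝓝[≠] a, F z = G z) : F a = G a :=
  tendsto_nhds_unique (hF.tendsto.mono_left nhdsWithin_le_nhds)
    ((hG.tendsto.mono_left nhdsWithin_le_nhds).congr' (h.mono fun _ hz => hz.symm))

/-- **The residue obstruction.**  See the module docstring. [folklore] -/
theorem no_quotient_primitive_of_logDeriv {a c : ℂ} {f g η : ℂ → ℂ} (hf : AnalyticAt ℂ f a)
    (hg : AnalyticAt ℂ g a) (hg0 : ¬ ∀ᶠ z in 𝓝 a, g z = 0) (hη : AnalyticAt ℂ η a) (hηa : η a = 0)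
    (hη0 : ¬ ∀ᶠ z in 𝓝 a, η z = 0) (hc : c ≠ 0)
    (h : ∀ᶠ z in 𝓝[≠] a, HasDerivAt (fun w => f w / g w) (c * (deriv η z / η z)) z) : False := by
  obtain ⟨k, g₂, hg₂, hg₂a, hgeq⟩ := hg.exists_eventuallyEq_pow_smul_nonzero_iff.2 hg0
  obtain ⟨m, u, hu, hua, hηeq⟩ := hη.exists_eventuallyEq_pow_smul_nonzero_iff.2 hη0
  have hm : m ≠ 0 := by
    rintro rfl
    apply hua
    have h0 := hηeq.self_of_nhds
    rw [pow_zero, one_smul] at h0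
    rw [← h0]; exact hηa
  -- neighbourhoods where the representations hold, as neighbourhoods of nearby points
  have hηη : ∀ᶠ z in 𝓝 a, ∀ᶠ w in 𝓝 z, η w = (w - a) ^ m • u w := eventually_eventually_nhds.2 hηeq
  have hgg : ∀ᶠ z in 𝓝 a, ∀ᶠ w in 𝓝 z, g w = (w - a) ^ k • g₂ w := eventually_eventually_nhds.2 hgeq
  have hu_an : ∀ᶠ z in 𝓝 a, AnalyticAt ℂ u z := hu.eventually_analyticAt
  have hg₂_an : ∀ᶠ z in 𝓝 a, AnalyticAt ℂ g₂ z := hg₂.eventually_analyticAt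
  have hune : ∀ᶠ z in 𝓝 a, u z ≠ 0 := hu.continuousAt.eventually_ne hua
  have hg₂ne : ∀ᶠ z in 𝓝 a, g₂ z ≠ 0 := hg₂.continuousAt.eventually_ne hg₂a
  -- the derivative of `η`
  have hderη : ∀ᶠ z in 𝓝 a, deriv η z = (m : ℂ) * (z - a) ^ (m - 1) * u z + (z - a) ^ m * deriv u z := by
    filter_upwards [hηη, hu_an] with z hz huz
    rw [Filter.EventuallyEq.deriv_eq hz]
    have hd : HasDerivAt (fun w => (w - a) ^ m • u w)
        ((m : ℂ) * (z - a) ^ (m - 1) * 1 * u z + (z - a) ^ m * deriv u z) z := by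
      have h1 := ((hasDerivAt_id z).sub_const a).pow m
      simp only [smul_eq_mul]
      exact h1.mul huz.differentiableAt.hasDerivAt
    rw [hd.deriv, mul_one]
  have hpunct : ∀ᶠ z in 𝓝[≠] a, z ≠ a := self_mem_nhdsWithin
  -- continuity of the comparison functions at `a`
  have hu_c : ContinuousAt u a := hu.continuousAt
  have hu'_c : ContinuousAt (deriv u) a := hu.deriv.continuousAt
  have hza : ContinuousAt (fun z : ℂ => z - a) a := continuousAt_id.sub continuousAt_const
  -- `c·η'/η·(z - a)·u = c (m u + (z - a) u')` on the punctured neighbourhood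
  have hrhs : ∀ᶠ z in 𝓝[≠] a, c * (deriv η z / η z) * ((z - a) * u z) =
      c * ((m : ℂ) * u z + (z - a) * deriv u z) := by
    filter_upwards [hpunct, nhdsWithin_le_nhds hderη, nhdsWithin_le_nhds hηeq,
      nhdsWithin_le_nhds hune] with z hz hdz hηz huz
    have hza0 : z - a ≠ 0 := sub_ne_zero.2 hz
    obtain ⟨m', rfl⟩ : ∃ m', m = m' + 1 := ⟨m - 1, (Nat.succ_pred_eq_of_ne_zero hm).symm⟩
    rw [hdz, hηz, smul_eq_mul, Nat.add_sub_cancel]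
    field_simp
    ring
  by_cases hf0 : ∀ᶠ z in 𝓝 a, f z = 0
  · -- `f ≡ 0`: then `η' = 0` near `a`, impossible at a zero of finite order
    have hff : ∀ᶠ z in 𝓝 a, ∀ᶠ w in 𝓝 z, f w = 0 := eventually_eventually_nhds.2 hf0
    have hid : ∀ᶠ z in 𝓝[≠] a, (0 : ℂ) = c * ((m : ℂ) * u z + (z - a) * deriv u z) := by
      filter_upwards [h, hrhs, nhdsWithin_le_nhds hff] with z hz hr hfz
      have h0 : HasDerivAt (fun w => f w / g w) 0 z := by
        refine (hasDerivAt_const z (0 : ℂ)).congr_of_eventuallyEq ?_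
        filter_upwards [hfz] with w hw
        rw [hw, zero_div]
      have := hz.unique h0
      rw [← hr, this, zero_mul]
    have hF : ContinuousAt (fun _ : ℂ => (0 : ℂ)) a := continuousAt_const
    have hG : ContinuousAt (fun z => c * ((m : ℂ) * u z + (z - a) * deriv u z)) a :=
      continuousAt_const.mul ((continuousAt_const.mul hu_c).add (hza.mul hu'_c))
    have heq := eq_at_of_eventuallyEq_punctured hF hG hid
    simp only [sub_self, zero_mul, add_zero] at heq
    exact mul_ne_zero hc (mul_ne_zero (Nat.cast_ne_zero.2 hm) hua) heq.symm
  · obtain ⟨j, f₂, hf₂, hf₂a, hfeq⟩ := hf.exists_eventuallyEq_pow_smul_nonzero_iff.2 hf0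
    have hff : ∀ᶠ z in 𝓝 a, ∀ᶠ w in 𝓝 z, f w = (w - a) ^ j • f₂ w := eventually_eventually_nhds.2 hfeq
    have hf₂_an : ∀ᶠ z in 𝓝 a, AnalyticAt ℂ f₂ z := hf₂.eventually_analyticAt
    -- `v = f₂/g₂`
    set v : ℂ → ℂ := fun z => f₂ z / g₂ z with hv
    have hv_an : AnalyticAt ℂ v a := hf₂.div hg₂ hg₂a
    have hva : v a ≠ 0 := div_ne_zero hf₂a hg₂a
    have hv_c : ContinuousAt v a := hv_an.continuousAt
    have hv'_c : ContinuousAt (deriv v) a := hv_an.deriv.continuousAt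
    have hv_an' : ∀ᶠ z in 𝓝 a, AnalyticAt ℂ v z := hv_an.eventually_analyticAt
    rcases le_or_gt k j with hkj | hjk
    · -- `f/g = (z - a)^d · v`, `d = j - k`
      set d := j - k with hd
      have hid : ∀ᶠ z in 𝓝[≠] a,
          u z * ((d : ℂ) * (z - a) ^ d * v z + (z - a) ^ (d + 1) * deriv v z) =
            c * ((m : ℂ) * u z + (z - a) * deriv u z) := by
        filter_upwards [h, hrhs, hpunct, nhdsWithin_le_nhds hff, nhdsWithin_le_nhds hgg,
          nhdsWithin_le_nhds hv_an', nhdsWithin_le_nhds hg₂ne, nhdsWithin_le_nhds hune,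
          nhdsWithin_le_nhds (eventually_eventually_nhds.2 hg₂ne)] with z hz hr hza hfz hgz hvz hg₂z huz hg₂g
        have hza0 : z - a ≠ 0 := sub_ne_zero.2 hza
        -- `f/g` agrees with `(w - a)^d v w` near `z`
        have hloc : (fun w => f w / g w) =ᶠ[𝓝 z] fun w => (w - a) ^ d * v w := by
          filter_upwards [hfz, hgz, eventually_ne_nhds hza, hg₂g] with w hfw hgw hwa hg₂w
          rw [hfw, hgw, smul_eq_mul, smul_eq_mul, hv]
          simp only
          have hwa0 : w - a ≠ 0 := sub_ne_zero.2 hwa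
          rw [show j = d + k by omega, pow_add]
          field_simp
        have hderiv : HasDerivAt (fun w => (w - a) ^ d * v w)
            ((d : ℂ) * (z - a) ^ (d - 1) * 1 * v z + (z - a) ^ d * deriv v z) z :=
          (((hasDerivAt_id z).sub_const a).pow d).mul hvz.differentiableAt.hasDerivAt
        have huniq := (hz.congr_of_eventuallyEq hloc.symm).unique hderiv
        -- multiply by `(z - a) u z`
        have hpow : (d : ℂ) * (z - a) ^ (d - 1) * (z - a) = (d : ℂ) * (z - a) ^ d := by
          rcases Nat.eq_zero_or_pos d with hd0 | hd0
          · rw [hd0]; simp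
          · obtain ⟨d', hd'⟩ : ∃ d', d = d' + 1 := ⟨d - 1, by omega⟩
            rw [hd', Nat.add_sub_cancel, pow_succ]; ring
        rw [← hr, huniq]
        linear_combination (-(u z * v z)) * hpow
      have hF : ContinuousAt (fun z => u z * ((d : ℂ) * (z - a) ^ d * v z + (z - a) ^ (d + 1) * deriv v z)) a :=
        hu_c.mul (((continuousAt_const.mul (hza.pow d)).mul hv_c).add ((hza.pow (d + 1)).mul hv'_c))
      have hG : ContinuousAt (fun z => c * ((m : ℂ) * u z + (z - a) * deriv u z)) a :=
        continuousAt_const.mul ((continuousAt_const.mul hu_c).add (hza.mul hu'_c))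
      have heq := eq_at_of_eventuallyEq_punctured hF hG hid
      have hl : u a * ((d : ℂ) * (a - a) ^ d * v a + (a - a) ^ (d + 1) * deriv v a) = 0 := by
        rcases Nat.eq_zero_or_pos d with hd0 | hd0
        · rw [hd0]; simp
        · rw [sub_self, zero_pow hd0.ne', zero_pow (Nat.succ_ne_zero d)]; ring
      rw [hl] at heq
      simp only [sub_self, zero_mul, add_zero] at heq
      exact mul_ne_zero hc (mul_ne_zero (Nat.cast_ne_zero.2 hm) hua) heq.symm
    · -- `f/g = v/(z - a)^d`, `d = k - j ≥ 1`
      set d := k - j with hd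
      have hd1 : 1 ≤ d := by omega
      have hid : ∀ᶠ z in 𝓝[≠] a,
          u z * (deriv v z * (z - a) - (d : ℂ) * v z) =
            c * ((m : ℂ) * u z + (z - a) * deriv u z) * (z - a) ^ d := by
        filter_upwards [h, hrhs, hpunct, nhdsWithin_le_nhds hff, nhdsWithin_le_nhds hgg,
          nhdsWithin_le_nhds hv_an', nhdsWithin_le_nhds hg₂ne, nhdsWithin_le_nhds hune,
          nhdsWithin_le_nhds (eventually_eventually_nhds.2 hg₂ne)] with z hz hr hza hfz hgz hvz hg₂z huz hg₂g
        have hza0 : z - a ≠ 0 := sub_ne_zero.2 hza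
        have hloc : (fun w => f w / g w) =ᶠ[𝓝 z] fun w => v w / (w - a) ^ d := by
          filter_upwards [hfz, hgz, eventually_ne_nhds hza, hg₂g] with w hfw hgw hwa hg₂w
          rw [hfw, hgw, smul_eq_mul, smul_eq_mul, hv]
          simp only
          have hwa0 : w - a ≠ 0 := sub_ne_zero.2 hwa
          rw [show k = d + j by omega, pow_add]
          field_simp
        have hderiv : HasDerivAt (fun w => v w / (w - a) ^ d)
            ((deriv v z * (z - a) ^ d - v z * ((d : ℂ) * (z - a) ^ (d - 1) * 1)) / ((z - a) ^ d) ^ 2) z :=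
          hvz.differentiableAt.hasDerivAt.div (((hasDerivAt_id z).sub_const a).pow d)
            (pow_ne_zero _ hza0)
        have huniq := (hz.congr_of_eventuallyEq hloc.symm).unique hderiv
        obtain ⟨d', hd'⟩ : ∃ d', d = d' + 1 := ⟨d - 1, by omega⟩
        have hr' : c * (deriv η z / η z) = c * ((m : ℂ) * u z + (z - a) * deriv u z) / ((z - a) * u z) :=
          (eq_div_iff (mul_ne_zero hza0 huz)).2 hr
        rw [hr', hd', Nat.add_sub_cancel] at huniq
        rw [hd']
        field_simp at huniq
        apply mul_right_cancel₀ (pow_ne_zero (d' + 1) hza0)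
        push_cast at huniq ⊢
        linear_combination -huniq
      have hF : ContinuousAt (fun z => u z * (deriv v z * (z - a) - (d : ℂ) * v z)) a :=
        hu_c.mul ((hv'_c.mul hza).sub (continuousAt_const.mul hv_c))
      have hG : ContinuousAt (fun z => c * ((m : ℂ) * u z + (z - a) * deriv u z) * (z - a) ^ d) a :=
        (continuousAt_const.mul ((continuousAt_const.mul hu_c).add (hza.mul hu'_c))).mul (hza.pow d)
      have heq := eq_at_of_eventuallyEq_punctured hF hG hid
      rw [sub_self, zero_pow (by omega : d ≠ 0), mul_zero, mul_zero, zero_sub] at heq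
      have : u a * (-((d : ℂ) * v a)) ≠ 0 :=
        mul_ne_zero hua (neg_ne_zero.2 (mul_ne_zero (Nat.cast_ne_zero.2 (by omega)) hva))
      exact this heq

/-! ## Part B. The analytic branch through a simple point of the fibre curve -/

/-- **The analytic branch of `Q(z, y) = 0` through `(a, 0)` when `q₀(a) = 0 ≠ q₁(a)`** (implicit
function theorem). [folklore] -/
theorem exists_zeroBranch (Q : ℂ[X][X]) {a : ℂ} (ha : (Q.coeff 0).IsRoot a)
    (ha' : ¬ (Q.coeff 1).IsRoot a) :
    ∃ η : ℂ → ℂ, AnalyticAt ℂ η a ∧ η a = 0 ∧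
      ∀ᶠ z in 𝓝 a, (Q.map (Polynomial.evalRingHom z)).eval (η z) = 0 := by
  classical
  set Φ : ℂ × ℂ → ℂ := fun v => ∑ j ∈ Finset.range (Q.natDegree + 1),
      (Q.coeff j).eval v.1 * v.2 ^ j with hΦ
  have hΦcd : ContDiff ℂ ω Φ := by
    simp only [hΦ]
    refine ContDiff.sum fun j _ => ContDiff.mul ?_ (contDiff_snd.pow _)
    have h1 : ContDiff ℂ ω (fun x : ℂ => (Q.coeff j).eval x) := by
      simpa only [Polynomial.aeval_def, Polynomial.eval₂_eq_eval_map, Algebra.algebraMap_self,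
        Polynomial.map_id] using (Q.coeff j).contDiff_aeval (𝕜 := ℂ) ω
    exact h1.comp contDiff_fst
  have hΦeq : ∀ z y : ℂ, Φ (z, y) = (Q.map (Polynomial.evalRingHom z)).eval y := fun z y =>
    (evalPP_eq_sum Q z y (Nat.lt_succ_self _)).symm
  have hΦa : Φ (a, 0) = 0 := by
    rw [hΦeq, ← Polynomial.coeff_zero_eq_eval_zero, Polynomial.coeff_map]
    exact ha
  -- the partial derivative in `y` at `(a, 0)` is multiplication by `q₁(a) ≠ 0`
  set Qa : ℂ[X] := Q.map (Polynomial.evalRingHom a) with hQa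
  have hQa' : (derivative Qa).eval 0 = (Q.coeff 1).eval a := by
    rw [← Polynomial.coeff_zero_eq_eval_zero, Polynomial.coeff_derivative, hQa, Polynomial.coeff_map]
    simp
  have hΦat : ContDiffAt ℂ ω Φ (a, (0 : ℂ)) := hΦcd.contDiffAt
  have hcomp : HasFDerivAt (fun y : ℂ => Φ (a, y))
      ((fderiv ℂ Φ (a, (0 : ℂ))).comp (ContinuousLinearMap.inr ℂ ℂ ℂ)) 0 :=
    (hΦat.differentiableAt (by simp)).hasFDerivAt.comp (0 : ℂ) (hasFDerivAt_prodMk_right a (0 : ℂ))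
  have hTd : HasFDerivAt (fun y : ℂ => Φ (a, y))
      (ContinuousLinearMap.smulRight (1 : ℂ →L[ℂ] ℂ) ((derivative Qa).eval 0)) 0 := by
    have e : (fun y : ℂ => Φ (a, y)) = fun y => Qa.eval y := funext fun y => hΦeq a y
    rw [e]
    exact (Polynomial.hasDerivAt Qa 0).hasFDerivAt
  have hD2 : (fderiv ℂ Φ (a, (0 : ℂ))).comp (ContinuousLinearMap.inr ℂ ℂ ℂ) =
      ContinuousLinearMap.smulRight (1 : ℂ →L[ℂ] ℂ) ((derivative Qa).eval 0) := hcomp.unique hTd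
  have hne : (derivative Qa).eval 0 ≠ 0 := by rw [hQa']; exact ha'
  have hinv : ((fderiv ℂ Φ (a, (0 : ℂ))).comp (ContinuousLinearMap.inr ℂ ℂ ℂ)).IsInvertible := by
    rw [hD2]
    refine ⟨ContinuousLinearEquiv.unitsEquivAut ℂ (Units.mk0 _ hne), ?_⟩
    ext
    simp [ContinuousLinearEquiv.unitsEquivAut_apply]
  have hω : (ω : ℕ∞ω) ≠ 0 := by simp
  set η : ℂ → ℂ := hΦat.implicitFunction hω hinv with hη
  refine ⟨η, (hΦat.contDiffAt_implicitFunction hω hinv).analyticAt,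
    hΦat.implicitFunction_apply_self hω hinv, ?_⟩
  have h := hΦat.eventually_apply_implicitFunction hω hinv
  rw [hΦa] at h
  filter_upwards [h] with z hz
  rw [← hΦeq]
  exact hz

end Summit.Schanuel.Schanuel.Theorems
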